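import Summits.NavierStokesRegularity.NavierStokesRegularity.Theorems.ExtremiserTransienceNearExtremalTransienceExtremiserLiouvilleConstantSpeedKKT
import Summits.NavierStokesRegularity.NavierStokesRegularity.Theorems.ExtremiserTransienceNearExtremalTransienceExtremiserLiouvilleConstantSpeedKKTTailTools
import HarnessLib

/-!
# Crux `ExtremiserTransience.NearExtremalTransience` (stmt-NavierStokesRegularity-21883), line `extremiser_liouville`,
# stub K1b — GLOBAL FIRST VARIATION: the KKT inequality along NON-compactly-supported directions of the extended class

`--supports stmt-NavierStokesRegularity-21883` (helper).  Author: prover seat `ns-el-k1b` (g5).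

The tree's first-order information on the K1b residue object (`ext_firstVariation_le_of_oneSided_normBound`,
`ext_firstVariation_le_of_sup_inner`, the multiplier measure `μ`) is along COMPACTLY SUPPORTED test fields.  The extended class
is invariant under a much larger GLOBAL TANGENT CLASS (`C^∞`, divergence free, bounded, bounded gradient, `D¹ψ, D²ψ ∈ L²`:
constants, translates `v(·+h) − v`, axial truncations of `v − c`, …), invisible to `μ` («mass at infinity»).  This file redoes
the perturbation calculus of `…KStarAttainedPerturbation` without `HasCompactSupport φ` (coefficient densities = bounded × L² × L²):
`integral_{stretching,normSq_curl,frobeniusNormSq}_add_smul_global`, `lintegral_iteratedFDeriv_add_smul_lt_top_global`;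
then `ext_firstVariation_le_of_oneSided_normBound_global` (**`‖v + εψ‖ ≤ (1 + mε)M` for small `ε ≥ 0` ⇒
`S·J₁(ψ) ≤ κ⋆²M²(mZW + W a₁(ψ) + Z c₁(ψ))`**), `ext_firstVariation_le_of_inner_le_global` (constant speed, `⟪v,ψ⟫ ≤ s`,
`‖ψ‖ ≤ P` ⇒ `ℓ(ψ) ≤ κ⋆²ZW·s`), and `firstVariation_translate_sub_le` (**TRANSLATION INEQUALITY**: for `ψ = v(·+h) − v`,
`⟪v,ψ⟫ = −‖ψ‖²/2 ≤ 0`, hence `ℓ(v(·+h)) ≤ ℓ(v) = S²` for every `h`).  USE (record `Lines/extremiser_liouville_k1b_jet.md` §4):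
step (i) of the proposed exclusion of the JET alternative by axial truncations `g(ξ)(v − c)` (`‖c + gV‖² = M² − g(1−g)‖V‖²`).

WHAT THIS IS NOT: K1b is NOT proved; nothing here proves NS regularity. [folklore]
-/

noncomputable section

open Set Filter Topology MeasureTheory Metric Function
open scoped ENNReal NNReal Topology InnerProductSpace RealInnerProductSpace ContDiff
open Literature.Analysis.FluidPDE Literature.Analysis

namespace Summit.NavierStokesRegularity.NavierStokesRegularity.Theorems

-- the problem directory repeats the summit name (`NavierStokesRegularity/NavierStokesRegularity`)
set_option linter.dupNamespace false

namespace ExtremiserLiouville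

open DepletionLadder.KStar
open Summit.NavierStokesRegularity.NavierStokesRegularity.Theorems.RungReynoldsOne.WeightedSlice

variable {v φ : EuclideanSpace ℝ (Fin 3) → EuclideanSpace ℝ (Fin 3)}

/-! ## `L²` bookkeeping for global directions -/

/-- **`Dᵏ(v + εψ) ∈ L²`** when `Dᵏv, Dᵏψ ∈ L²` (global `ψ`). [folklore] -/
theorem lintegral_iteratedFDeriv_add_smul_lt_top_global (hv : ContDiff ℝ ∞ v) (hφ : ContDiff ℝ ∞ φ) (ε : ℝ) {k : ℕ}
    (hk : ∫⁻ x, ‖iteratedFDeriv ℝ k v x‖ₑ ^ 2 < ⊤) (hkφ : ∫⁻ x, ‖iteratedFDeriv ℝ k φ x‖ₑ ^ 2 < ⊤) :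
    ∫⁻ x, ‖iteratedFDeriv ℝ k (fun y => v y + ε • φ y) x‖ₑ ^ 2 < ⊤ := by
  have hcv : Continuous (iteratedFDeriv ℝ k v) := hv.continuous_iteratedFDeriv (by exact_mod_cast le_top)
  have hcφ : Continuous (iteratedFDeriv ℝ k φ) := hφ.continuous_iteratedFDeriv (by exact_mod_cast le_top)
  have h1 : MemLp (iteratedFDeriv ℝ k v) 2 (volume : Measure (EuclideanSpace ℝ (Fin 3))) :=
    ⟨hcv.aestronglyMeasurable, lintegral_enorm_sq_lt_top_iff_eLpNorm.1 hk⟩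
  have h2 : MemLp (iteratedFDeriv ℝ k φ) 2 (volume : Measure (EuclideanSpace ℝ (Fin 3))) :=
    ⟨hcφ.aestronglyMeasurable, lintegral_enorm_sq_lt_top_iff_eLpNorm.1 hkφ⟩
  have h3 : MemLp (fun x => iteratedFDeriv ℝ k v x + ε • iteratedFDeriv ℝ k φ x) 2 volume := h1.add (h2.const_smul ε)
  have heq : (fun x => iteratedFDeriv ℝ k (fun y => v y + ε • φ y) x) =
      fun x => iteratedFDeriv ℝ k v x + ε • iteratedFDeriv ℝ k φ x := funext fun x => iteratedFDeriv_add_smul hv hφ ε k x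
  rw [lintegral_enorm_sq_lt_top_iff_eLpNorm]
  change eLpNorm (fun x => iteratedFDeriv ℝ k (fun y => v y + ε • φ y) x) 2 volume < ⊤
  rw [heq]
  exact h3.2

/-- The three mixed stretching coefficients along `v + εψ` are integrable for GLOBAL `ψ` with bounded gradient and
`curl ψ ∈ L²` (each density is `≤ const · |L² function| · |L² function|`). [folklore] -/
theorem integrable_stretching_coeffs_global (hv : ContDiff ℝ ∞ v) (hφ : ContDiff ℝ ∞ φ) {B C : ℝ}
    (hB : ∀ x, ‖fderiv ℝ v x‖ ≤ B) (hC : ∀ x, ‖fderiv ℝ φ x‖ ≤ C)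
    (h1 : ∫⁻ x, ‖iteratedFDeriv ℝ 1 v x‖ₑ ^ 2 < ⊤) (h1φ : ∫⁻ x, ‖iteratedFDeriv ℝ 1 φ x‖ₑ ^ 2 < ⊤) :
    Integrable (fun x => ⟪curl φ x, fderiv ℝ v x (curl v x)⟫ + ⟪curl v x, fderiv ℝ φ x (curl v x)⟫ +
        ⟪curl v x, fderiv ℝ v x (curl φ x)⟫) (volume : Measure (EuclideanSpace ℝ (Fin 3))) ∧
      Integrable (fun x => ⟪curl φ x, fderiv ℝ φ x (curl v x)⟫ + ⟪curl φ x, fderiv ℝ v x (curl φ x)⟫ +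
        ⟪curl v x, fderiv ℝ φ x (curl φ x)⟫) (volume : Measure (EuclideanSpace ℝ (Fin 3))) ∧
      Integrable (fun x => ⟪curl φ x, fderiv ℝ φ x (curl φ x)⟫) (volume : Measure (EuclideanSpace ℝ (Fin 3))) := by
  have cω : Continuous (curl v) := continuous_curl (hv.of_le (by norm_cast))
  have cψ : Continuous (curl φ) := continuous_curl (hφ.of_le (by norm_cast))
  have cDv : Continuous (fderiv ℝ v) := hv.continuous_fderiv (by simp)
  have cDφ : Continuous (fderiv ℝ φ) := hφ.continuous_fderiv (by simp)
  have l2ω := DepletionLadder.KStar.lintegral_enorm_curl_sq_lt_top hv h1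
  have l2ψ := DepletionLadder.KStar.lintegral_enorm_curl_sq_lt_top hφ h1φ
  -- generic: `⟪a, L b⟫` with `‖L‖ ≤ K` is integrable when `a, b ∈ L²`
  have key : ∀ {a b : EuclideanSpace ℝ (Fin 3) → EuclideanSpace ℝ (Fin 3)}
      {L : EuclideanSpace ℝ (Fin 3) → (EuclideanSpace ℝ (Fin 3) →L[ℝ] EuclideanSpace ℝ (Fin 3))} {K : ℝ},
      Continuous a → Continuous b → Continuous L → (∀ x, ‖L x‖ ≤ K) →
      (∫⁻ x, ‖a x‖ₑ ^ 2 < ⊤) → (∫⁻ x, ‖b x‖ₑ ^ 2 < ⊤) →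
      Integrable (fun x => ⟪a x, L x (b x)⟫) (volume : Measure (EuclideanSpace ℝ (Fin 3))) := by
    intro a b L K ha hb hL hK ha2 hb2
    refine integrable_of_norm_le_const_mul_mul K (ha.inner (hL.clm_apply hb)) ha hb ha2 hb2 fun x => ?_
    calc ‖⟪a x, L x (b x)⟫‖ ≤ ‖a x‖ * ‖L x (b x)‖ := norm_inner_le_norm _ _
      _ ≤ ‖a x‖ * (K * ‖b x‖) := mul_le_mul_of_nonneg_left ((L x).le_of_opNorm_le (hK x) _) (norm_nonneg _)
      _ = K * ‖a x‖ * ‖b x‖ := by ring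
  refine ⟨((key cψ cω cDv hB l2ψ l2ω).add (key cω cω cDφ hC l2ω l2ω)).add (key cω cψ cDv hB l2ω l2ψ),
    ((key cψ cω cDφ hC l2ψ l2ω).add (key cψ cψ cDv hB l2ψ l2ψ)).add (key cω cψ cDφ hC l2ω l2ψ),
    key cψ cψ cDφ hC l2ψ l2ψ⟩

/-- The enstrophy coefficients `⟪ω, curl ψ⟫`, `‖curl ψ‖²` are integrable for global `ψ` with `D¹ψ ∈ L²`. [folklore] -/
theorem integrable_enstrophy_coeffs_global (hv : ContDiff ℝ ∞ v) (hφ : ContDiff ℝ ∞ φ)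
    (h1 : ∫⁻ x, ‖iteratedFDeriv ℝ 1 v x‖ₑ ^ 2 < ⊤) (h1φ : ∫⁻ x, ‖iteratedFDeriv ℝ 1 φ x‖ₑ ^ 2 < ⊤) :
    Integrable (fun x => ⟪curl v x, curl φ x⟫) (volume : Measure (EuclideanSpace ℝ (Fin 3))) ∧
      Integrable (fun x => ‖curl φ x‖ ^ 2) (volume : Measure (EuclideanSpace ℝ (Fin 3))) := by
  have cω : Continuous (curl v) := continuous_curl (hv.of_le (by norm_cast))
  have cψ : Continuous (curl φ) := continuous_curl (hφ.of_le (by norm_cast))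
  have l2ω := DepletionLadder.KStar.lintegral_enorm_curl_sq_lt_top hv h1
  have l2ψ := DepletionLadder.KStar.lintegral_enorm_curl_sq_lt_top hφ h1φ
  refine ⟨integrable_of_norm_le_const_mul_mul 1 (cω.inner cψ) cω cψ l2ω l2ψ fun x => ?_,
    (integrable_norm_curl_sq (hφ.of_le (by norm_cast)) h1φ).1⟩
  rw [one_mul]
  exact norm_inner_le_norm _ _

/-- The palinstrophy coefficients `Σᵢ⟪∂ᵢω, ∂ᵢ curl ψ⟫`, `|D curl ψ|²_F` are integrable for global `ψ` with `D²ψ ∈ L²`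
(Young: `|Σᵢ⟪∂ᵢω, ∂ᵢcurl ψ⟫| ≤ ½|Dω|²_F + ½|D curl ψ|²_F`). [folklore] -/
theorem integrable_palinstrophy_coeffs_global (hv : ContDiff ℝ ∞ v) (hφ : ContDiff ℝ ∞ φ)
    (h2 : ∫⁻ x, ‖iteratedFDeriv ℝ 2 v x‖ₑ ^ 2 < ⊤) (h2φ : ∫⁻ x, ‖iteratedFDeriv ℝ 2 φ x‖ₑ ^ 2 < ⊤) :
    Integrable (fun x => ∑ i, ⟪fderiv ℝ (curl v) x (EuclideanSpace.basisFun (Fin 3) ℝ i),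
        fderiv ℝ (curl φ) x (EuclideanSpace.basisFun (Fin 3) ℝ i)⟫)
        (volume : Measure (EuclideanSpace ℝ (Fin 3))) ∧
      Integrable (fun x => frobeniusNormSq (fderiv ℝ (curl φ) x))
        (volume : Measure (EuclideanSpace ℝ (Fin 3))) := by
  have hω1 : ContDiff ℝ 1 (curl v) := contDiff_curl (n := 1) (hv.of_le (by norm_cast))
  have hψ1 : ContDiff ℝ 1 (curl φ) := contDiff_curl (n := 1) (hφ.of_le (by norm_cast))
  have cDω : Continuous (fderiv ℝ (curl v)) := hω1.continuous_fderiv one_ne_zero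
  have cDψ : Continuous (fderiv ℝ (curl φ)) := hψ1.continuous_fderiv one_ne_zero
  have iω := (integrable_frobeniusNormSq_fderiv_curl (hv.of_le (by norm_cast)) h2).1
  have iψ := (integrable_frobeniusNormSq_fderiv_curl (hφ.of_le (by norm_cast)) h2φ).1
  refine ⟨?_, iψ⟩
  refine ((iω.const_mul (1 / 2)).add (iψ.const_mul (1 / (2 * 1)))).mono' ?_ (Eventually.of_forall fun x => ?_)
  · exact (continuous_finsetSum _ fun i _ =>
      (cDω.clm_apply continuous_const).inner (cDψ.clm_apply continuous_const)).aestronglyMeasurable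
  · rw [Real.norm_eq_abs]
    exact sum_inner_le_frobeniusNormSq _ _ one_pos

/-! ## The three expansions along `v + εψ`, global `ψ` -/

/-- **Expansion of the stretching integral** along a global direction: `J(v+εψ) = J + εJ₁ + ε²J₂ + ε³J₃`. [folklore] -/
theorem integral_stretching_add_smul_global (hv : ContDiff ℝ ∞ v) (hφ : ContDiff ℝ ∞ φ) {B C : ℝ}
    (hB : ∀ x, ‖fderiv ℝ v x‖ ≤ B) (hC : ∀ x, ‖fderiv ℝ φ x‖ ≤ C)
    (h1 : ∫⁻ x, ‖iteratedFDeriv ℝ 1 v x‖ₑ ^ 2 < ⊤) (h1φ : ∫⁻ x, ‖iteratedFDeriv ℝ 1 φ x‖ₑ ^ 2 < ⊤) (ε : ℝ) :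
    ∫ x, ⟪curl (fun y => v y + ε • φ y) x,
        fderiv ℝ (fun y => v y + ε • φ y) x (curl (fun y => v y + ε • φ y) x)⟫ =
      (∫ x, ⟪curl v x, fderiv ℝ v x (curl v x)⟫) +
        ε * (∫ x, (⟪curl φ x, fderiv ℝ v x (curl v x)⟫ + ⟪curl v x, fderiv ℝ φ x (curl v x)⟫ +
          ⟪curl v x, fderiv ℝ v x (curl φ x)⟫)) +
        ε ^ 2 * (∫ x, (⟪curl φ x, fderiv ℝ φ x (curl v x)⟫ + ⟪curl φ x, fderiv ℝ v x (curl φ x)⟫ +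
          ⟪curl v x, fderiv ℝ φ x (curl φ x)⟫)) +
        ε ^ 3 * (∫ x, ⟪curl φ x, fderiv ℝ φ x (curl φ x)⟫) := by
  have hvd : Differentiable ℝ v := hv.differentiable (by simp)
  have hφd : Differentiable ℝ φ := hφ.differentiable (by simp)
  have i0 := integrable_stretching hv hB h1
  obtain ⟨i1, i2, i3⟩ := integrable_stretching_coeffs_global hv hφ hB hC h1 h1φ
  have hpt : ∀ x, ⟪curl (fun y => v y + ε • φ y) x,
      fderiv ℝ (fun y => v y + ε • φ y) x (curl (fun y => v y + ε • φ y) x)⟫ =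
      ⟪curl v x, fderiv ℝ v x (curl v x)⟫ +
        ε * (⟪curl φ x, fderiv ℝ v x (curl v x)⟫ + ⟪curl v x, fderiv ℝ φ x (curl v x)⟫ +
          ⟪curl v x, fderiv ℝ v x (curl φ x)⟫) +
        ε ^ 2 * (⟪curl φ x, fderiv ℝ φ x (curl v x)⟫ + ⟪curl φ x, fderiv ℝ v x (curl φ x)⟫ +
          ⟪curl v x, fderiv ℝ φ x (curl φ x)⟫) +
        ε ^ 3 * ⟪curl φ x, fderiv ℝ φ x (curl φ x)⟫ := by
    intro x
    rw [curl_add_smul hvd hφd, fderiv_add_smul hvd hφd]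
    exact inner_apply_add_smul_expand _ _ _ _ ε
  rw [integral_congr_ae (Eventually.of_forall hpt), integral_add ?_ ?_, integral_add ?_ ?_,
    integral_add ?_ ?_, integral_const_mul, integral_const_mul, integral_const_mul]
  · exact i0
  · exact i1.const_mul ε
  · exact i0.add (i1.const_mul ε)
  · exact i2.const_mul _
  · exact (i0.add (i1.const_mul ε)).add (i2.const_mul _)
  · exact i3.const_mul _

/-- **Expansion of the enstrophy** along a global direction: `‖curl(v+εψ)‖₂² = Z + 2εa₁ + ε²a₂`. [folklore] -/
theorem integral_normSq_curl_add_smul_global (hv : ContDiff ℝ ∞ v) (hφ : ContDiff ℝ ∞ φ)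
    (h1 : ∫⁻ x, ‖iteratedFDeriv ℝ 1 v x‖ₑ ^ 2 < ⊤) (h1φ : ∫⁻ x, ‖iteratedFDeriv ℝ 1 φ x‖ₑ ^ 2 < ⊤) (ε : ℝ) :
    ∫ x, ‖curl (fun y => v y + ε • φ y) x‖ ^ 2 =
      (∫ x, ‖curl v x‖ ^ 2) + 2 * ε * (∫ x, ⟪curl v x, curl φ x⟫) + ε ^ 2 * (∫ x, ‖curl φ x‖ ^ 2) := by
  have hvd : Differentiable ℝ v := hv.differentiable (by simp)
  have hφd : Differentiable ℝ φ := hφ.differentiable (by simp)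
  have i0 := (integrable_norm_curl_sq (hv.of_le (by norm_cast)) h1).1
  obtain ⟨i1, i2⟩ := integrable_enstrophy_coeffs_global hv hφ h1 h1φ
  have hpt : ∀ x, ‖curl (fun y => v y + ε • φ y) x‖ ^ 2 =
      ‖curl v x‖ ^ 2 + 2 * ε * ⟪curl v x, curl φ x⟫ + ε ^ 2 * ‖curl φ x‖ ^ 2 := by
    intro x
    rw [curl_add_smul hvd hφd]
    exact norm_add_smul_sq_expand _ _ ε
  rw [integral_congr_ae (Eventually.of_forall hpt), integral_add ?_ ?_, integral_add ?_ ?_,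
    integral_const_mul, integral_const_mul]
  · exact i0
  · exact i1.const_mul _
  · exact i0.add (i1.const_mul _)
  · exact i2.const_mul _

/-- **Expansion of the palinstrophy** along a global direction: `‖∇curl(v+εψ)‖₂² = W + 2εc₁ + ε²c₂`. [folklore] -/
theorem integral_frobeniusNormSq_add_smul_global (hv : ContDiff ℝ ∞ v) (hφ : ContDiff ℝ ∞ φ)
    (h2 : ∫⁻ x, ‖iteratedFDeriv ℝ 2 v x‖ₑ ^ 2 < ⊤) (h2φ : ∫⁻ x, ‖iteratedFDeriv ℝ 2 φ x‖ₑ ^ 2 < ⊤) (ε : ℝ) :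
    ∫ x, frobeniusNormSq (fderiv ℝ (curl (fun y => v y + ε • φ y)) x) =
      (∫ x, frobeniusNormSq (fderiv ℝ (curl v) x)) +
        2 * ε * (∫ x, ∑ i, ⟪fderiv ℝ (curl v) x (EuclideanSpace.basisFun (Fin 3) ℝ i),
          fderiv ℝ (curl φ) x (EuclideanSpace.basisFun (Fin 3) ℝ i)⟫) +
        ε ^ 2 * (∫ x, frobeniusNormSq (fderiv ℝ (curl φ) x)) := by
  have i0 := (integrable_frobeniusNormSq_fderiv_curl (hv.of_le (by norm_cast)) h2).1
  obtain ⟨i1, i2⟩ := integrable_palinstrophy_coeffs_global hv hφ h2 h2φ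
  have hpt : ∀ x, frobeniusNormSq (fderiv ℝ (curl (fun y => v y + ε • φ y)) x) =
      frobeniusNormSq (fderiv ℝ (curl v) x) +
        2 * ε * (∑ i, ⟪fderiv ℝ (curl v) x (EuclideanSpace.basisFun (Fin 3) ℝ i),
          fderiv ℝ (curl φ) x (EuclideanSpace.basisFun (Fin 3) ℝ i)⟫) +
        ε ^ 2 * frobeniusNormSq (fderiv ℝ (curl φ) x) := by
    intro x
    rw [fderiv_curl_add_smul hv hφ]
    exact frobeniusNormSq_add_smul_expand _ _ ε
  rw [integral_congr_ae (Eventually.of_forall hpt), integral_add ?_ ?_, integral_add ?_ ?_,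
    integral_const_mul, integral_const_mul]
  · exact i0
  · exact i1.const_mul _
  · exact i0.add (i1.const_mul _)
  · exact i2.const_mul _

/-! ## The global one-sided first variation of an extended extremiser -/

/-- **One-sided first variation of an EXTENDED extremiser along a GLOBAL direction.**  `v` extended extremiser
(`|S| = κ⋆M√Z√W`), `ψ` smooth divergence free with bounded gradient and `D¹ψ, D²ψ ∈ L²` (no compact support), and
`‖v + εψ‖ ≤ (1 + mε)M` for `0 ≤ ε < ε₀`: then `S·J₁(ψ) ≤ κ⋆² M² (m Z W + W a₁(ψ) + Z c₁(ψ))`. [folklore] -/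
theorem ext_firstVariation_le_of_oneSided_normBound_global
    (hv : ContDiff ℝ ∞ v) (hdiv : VectorCalculus.IsDivFree v)
    {M B : ℝ} (hB : ∀ x, ‖fderiv ℝ v x‖ ≤ B)
    (h1 : ∫⁻ x, ‖iteratedFDeriv ℝ 1 v x‖ₑ ^ 2 < ⊤) (h2 : ∫⁻ x, ‖iteratedFDeriv ℝ 2 v x‖ₑ ^ 2 < ⊤)
    (hatt : |∫ x, ⟪curl v x, fderiv ℝ v x (curl v x)⟫| = (sInf {κ : ℝ | (∀ (v : EuclideanSpace ℝ (Fin 3) → EuclideanSpace ℝ (Fin 3)) (M B : ℝ), ContDiff ℝ (⊤ : ℕ∞) v → Literature.Analysis.FluidPDE.VectorCalculus.IsDivFree v → (∀ x, ‖v x‖ ≤ M) → (∀ x, ‖fderiv ℝ v x‖ ≤ B) → (∫⁻ x, ‖iteratedFDeriv ℝ 0 v x‖ₑ ^ 2 < ⊤) → (∫⁻ x, ‖iteratedFDeriv ℝ 1 v x‖ₑ ^ 2 < ⊤) → (∫⁻ x, ‖iteratedFDeriv ℝ 2 v x‖ₑ ^ 2 < ⊤) → |∫ x, ⟪Literature.Analysis.FluidPDE.curl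 v x, fderiv ℝ v x (Literature.Analysis.FluidPDE.curl v x)⟫_ℝ| ≤ κ * M * Real.sqrt (∫ x, ‖Literature.Analysis.FluidPDE.curl v x‖ ^ 2) * Real.sqrt (∫ x, Literature.Analysis.FluidPDE.frobeniusNormSq (fderiv ℝ (Literature.Analysis.FluidPDE.curl v) x)))}) * M * Real.sqrt (∫ x, ‖curl v x‖ ^ 2) * Real.sqrt (∫ x, frobeniusNormSq (fderiv ℝ (curl v) x)))
    (hφ : ContDiff ℝ ∞ φ) (hφdiv : VectorCalculus.IsDivFree φ) {C : ℝ} (hC : ∀ x, ‖fderiv ℝ φ x‖ ≤ C)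
    (h1φ : ∫⁻ x, ‖iteratedFDeriv ℝ 1 φ x‖ₑ ^ 2 < ⊤) (h2φ : ∫⁻ x, ‖iteratedFDeriv ℝ 2 φ x‖ₑ ^ 2 < ⊤)
    {m ε₀ : ℝ} (hε₀ : 0 < ε₀) (hbound : ∀ ε : ℝ, 0 ≤ ε → ε < ε₀ → ∀ x, ‖v x + ε • φ x‖ ≤ (1 + m * ε) * M) :
    (∫ x, ⟪curl v x, fderiv ℝ v x (curl v x)⟫) * (∫ x, (⟪curl φ x, fderiv ℝ v x (curl v x)⟫ + ⟪curl v x, fderiv ℝ φ x (curl v x)⟫ + ⟪curl v x, fderiv ℝ v x (curl φ x)⟫)) ≤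
      (sInf {κ : ℝ | (∀ (v : EuclideanSpace ℝ (Fin 3) → EuclideanSpace ℝ (Fin 3)) (M B : ℝ), ContDiff ℝ (⊤ : ℕ∞) v → Literature.Analysis.FluidPDE.VectorCalculus.IsDivFree v → (∀ x, ‖v x‖ ≤ M) → (∀ x, ‖fderiv ℝ v x‖ ≤ B) → (∫⁻ x, ‖iteratedFDeriv ℝ 0 v x‖ₑ ^ 2 < ⊤) → (∫⁻ x, ‖iteratedFDeriv ℝ 1 v x‖ₑ ^ 2 < ⊤) → (∫⁻ x, ‖iteratedFDeriv ℝ 2 v x‖ₑ ^ 2 < ⊤) → |∫ x, ⟪Literature.Analysis.FluidPDE.curl v x, fderiv ℝ v x (Literature.Analysis.FluidPDE.curl v x)⟫_ℝ| ≤ κ * M * Real.sqrt (∫ x, ‖Literature.Analysis.FluidPDE.curl v x‖ ^ 2) * Real.sqrt (∫ x, Literature.Analysis.FluidPDE.frobeniusNormSq (fderiv ℝ (Literature.Analysis.FluidPDE.curl v) x)))}) ^ 2 * M ^ 2 * (m * (∫ x, ‖curl v x‖ ^ 2) * (∫ x, frobeniusNormSq (fderiv ℝ (curl v) x)) + (∫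 x, frobeniusNormSq (fderiv ℝ (curl v) x)) * (∫ x, ⟪curl v x, curl φ x⟫) + (∫ x, ‖curl v x‖ ^ 2) * (∫ x, ∑ i, ⟪fderiv ℝ (curl v) x (EuclideanSpace.basisFun (Fin 3) ℝ i), fderiv ℝ (curl φ) x (EuclideanSpace.basisFun (Fin 3) ℝ i)⟫)) := by
  have hext := extendedSharp
  set K : ℝ := (sInf {κ : ℝ | (∀ (v : EuclideanSpace ℝ (Fin 3) → EuclideanSpace ℝ (Fin 3)) (M B : ℝ), ContDiff ℝ (⊤ : ℕ∞) v → Literature.Analysis.FluidPDE.VectorCalculus.IsDivFree v → (∀ x, ‖v x‖ ≤ M) → (∀ x, ‖fderiv ℝ v x‖ ≤ B) → (∫⁻ x, ‖iteratedFDeriv ℝ 0 v x‖ₑ ^ 2 < ⊤) → (∫⁻ x, ‖iteratedFDeriv ℝ 1 v x‖ₑ ^ 2 < ⊤) → (∫⁻ x, ‖iteratedFDeriv ℝ 2 v x‖ₑ ^ 2 < ⊤) → |∫ x, ⟪Literature.Analysis.FluidPDE.curl v x, fderiv ℝ v x (Literature.Analysis.FluidPDE.curl v x)⟫_ℝ|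 ≤ κ * M * Real.sqrt (∫ x, ‖Literature.Analysis.FluidPDE.curl v x‖ ^ 2) * Real.sqrt (∫ x, Literature.Analysis.FluidPDE.frobeniusNormSq (fderiv ℝ (Literature.Analysis.FluidPDE.curl v) x)))}) with hK
  have hZ0 : 0 ≤ (∫ x, ‖curl v x‖ ^ 2) := integral_nonneg fun x => sq_nonneg _
  have hW0 : 0 ≤ (∫ x, frobeniusNormSq (fderiv ℝ (curl v) x)) := integral_nonneg fun x => frobeniusNormSq_nonneg _
  have hvd : Differentiable ℝ v := hv.differentiable (by simp)
  have hφd : Differentiable ℝ φ := hφ.differentiable (by simp)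
  refine HalfSpace.linear_coeff_le_of_sq_le_oneSided hε₀
    (J₂ := ∫ x, (⟪curl φ x, fderiv ℝ φ x (curl v x)⟫ + ⟪curl φ x, fderiv ℝ v x (curl φ x)⟫ +
      ⟪curl v x, fderiv ℝ φ x (curl φ x)⟫))
    (J₃ := ∫ x, ⟪curl φ x, fderiv ℝ φ x (curl φ x)⟫) (a₂ := ∫ x, ‖curl φ x‖ ^ 2)
    (c₂ := ∫ x, frobeniusNormSq (fderiv ℝ (curl φ) x)) ?_ fun ε hε0 hε => ?_
  · calc (∫ x, ⟪curl v x, fderiv ℝ v x (curl v x)⟫) ^ 2 = |∫ x, ⟪curl v x, fderiv ℝ v x (curl v x)⟫| ^ 2 := (sq_abs _).symm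
      _ = (K * M * Real.sqrt (∫ x, ‖curl v x‖ ^ 2) * Real.sqrt (∫ x, frobeniusNormSq (fderiv ℝ (curl v) x))) ^ 2 := by rw [hatt]
      _ = K ^ 2 * M ^ 2 * (∫ x, ‖curl v x‖ ^ 2) * (∫ x, frobeniusNormSq (fderiv ℝ (curl v) x)) := by
          rw [mul_pow, mul_pow, mul_pow, Real.sq_sqrt hZ0, Real.sq_sqrt hW0]
  · -- the perturbed field is in the extended class
    have hcd : ContDiff ℝ ∞ (fun y => v y + ε • φ y) := hv.add (hφ.const_smul ε)
    have hdv : VectorCalculus.IsDivFree (fun y => v y + ε • φ y) := fun x => by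
      rw [divergence_add_smul hvd hφd, hdiv x, hφdiv x, mul_zero, add_zero]
    have hB' : ∀ x, ‖fderiv ℝ (fun y => v y + ε • φ y) x‖ ≤ B + |ε| * C := fun x => by
      rw [fderiv_add_smul hvd hφd]
      calc ‖fderiv ℝ v x + ε • fderiv ℝ φ x‖ ≤ ‖fderiv ℝ v x‖ + ‖ε • fderiv ℝ φ x‖ := norm_add_le _ _
        _ = ‖fderiv ℝ v x‖ + |ε| * ‖fderiv ℝ φ x‖ := by rw [norm_smul, Real.norm_eq_abs]
        _ ≤ B + |ε| * C := add_le_add (hB x) (mul_le_mul_of_nonneg_left (hC x) (abs_nonneg ε))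
    have h1' := lintegral_iteratedFDeriv_add_smul_lt_top_global hv hφ ε h1 h1φ
    have h2' := lintegral_iteratedFDeriv_add_smul_lt_top_global hv hφ ε h2 h2φ
    have hu := hext _ ((1 + m * ε) * M) (B + |ε| * C) hcd hdv (hbound ε hε0 hε) hB' h1' h2'
    have hZε : 0 ≤ ∫ x, ‖curl (fun y => v y + ε • φ y) x‖ ^ 2 := integral_nonneg fun x => sq_nonneg _
    have hWε : 0 ≤ ∫ x, frobeniusNormSq (fderiv ℝ (curl (fun y => v y + ε • φ y)) x) := integral_nonneg fun x => frobeniusNormSq_nonneg _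
    have hsq : (∫ x, ⟪curl (fun y => v y + ε • φ y) x,
        fderiv ℝ (fun y => v y + ε • φ y) x (curl (fun y => v y + ε • φ y) x)⟫) ^ 2 ≤
        (K * ((1 + m * ε) * M) * Real.sqrt (∫ x, ‖curl (fun y => v y + ε • φ y) x‖ ^ 2) *
          Real.sqrt (∫ x, frobeniusNormSq (fderiv ℝ (curl (fun y => v y + ε • φ y)) x))) ^ 2 := by
      rw [← sq_abs (∫ x, ⟪curl (fun y => v y + ε • φ y) x,
        fderiv ℝ (fun y => v y + ε • φ y) x (curl (fun y => v y + ε • φ y) x)⟫)]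
      exact pow_le_pow_left₀ (abs_nonneg _) hu 2
    rw [mul_pow, mul_pow, mul_pow, Real.sq_sqrt hZε, Real.sq_sqrt hWε,
      integral_stretching_add_smul_global hv hφ hB hC h1 h1φ ε, integral_normSq_curl_add_smul_global hv hφ h1 h1φ ε,
      integral_frobeniusNormSq_add_smul_global hv hφ h2 h2φ ε] at hsq
    exact hsq

/-- **The KKT inequality of a constant-speed extended extremiser along a GLOBAL direction.**  If `‖v‖ ≡ M > 0`,
`|S| = κ⋆M√Z√W`, and `ψ` is a global direction (smooth, divergence free, `‖ψ‖ ≤ P`, `‖Dψ‖ ≤ C`, `D¹ψ, D²ψ ∈ L²`) with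
`⟪v x, ψ x⟫ ≤ s` for all `x`, then `S·J₁(ψ) ≤ κ⋆²M²((s/M²)ZW + W a₁(ψ) + Z c₁(ψ))`, i.e. `ℓ(ψ) ≤ κ⋆²ZW·s`. [folklore] -/
theorem ext_firstVariation_le_of_inner_le_global
    (hv : ContDiff ℝ ∞ v) (hdiv : VectorCalculus.IsDivFree v) {M B : ℝ} (hMpos : 0 < M)
    (hM : ∀ x, ‖v x‖ = M) (hB : ∀ x, ‖fderiv ℝ v x‖ ≤ B)
    (h1 : ∫⁻ x, ‖iteratedFDeriv ℝ 1 v x‖ₑ ^ 2 < ⊤) (h2 : ∫⁻ x, ‖iteratedFDeriv ℝ 2 v x‖ₑ ^ 2 < ⊤)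
    (hatt : |∫ x, ⟪curl v x, fderiv ℝ v x (curl v x)⟫| = (sInf {κ : ℝ | (∀ (v : EuclideanSpace ℝ (Fin 3) → EuclideanSpace ℝ (Fin 3)) (M B : ℝ), ContDiff ℝ (⊤ : ℕ∞) v → Literature.Analysis.FluidPDE.VectorCalculus.IsDivFree v → (∀ x, ‖v x‖ ≤ M) → (∀ x, ‖fderiv ℝ v x‖ ≤ B) → (∫⁻ x, ‖iteratedFDeriv ℝ 0 v x‖ₑ ^ 2 < ⊤) → (∫⁻ x, ‖iteratedFDeriv ℝ 1 v x‖ₑ ^ 2 < ⊤) → (∫⁻ x, ‖iteratedFDeriv ℝ 2 v x‖ₑ ^ 2 < ⊤) → |∫ x, ⟪Literature.Analysis.FluidPDE.curl v x, fderiv ℝ v x (Literature.Analysis.FluidPDE.curl v x)⟫_ℝ| ≤ κ * M * Real.sqrt (∫ x, ‖Literature.Analysis.FluidPDE.curl v x‖ ^ 2) * Real.sqrt (∫ x, Literature.Analysis.FluidPDE.frobeniusNormSq (fderiv ℝ (Literature.Analysis.FluidPDE.curl v) x)))}) * M * Real.sqrt (∫ x, ‖curl v x‖ ^ 2) * Real.sqrt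 (∫ x, frobeniusNormSq (fderiv ℝ (curl v) x)))
    (hφ : ContDiff ℝ ∞ φ) (hφdiv : VectorCalculus.IsDivFree φ) {P C : ℝ} (hP : ∀ x, ‖φ x‖ ≤ P) (hC : ∀ x, ‖fderiv ℝ φ x‖ ≤ C)
    (h1φ : ∫⁻ x, ‖iteratedFDeriv ℝ 1 φ x‖ₑ ^ 2 < ⊤) (h2φ : ∫⁻ x, ‖iteratedFDeriv ℝ 2 φ x‖ₑ ^ 2 < ⊤)
    {s : ℝ} (hs : ∀ x, ⟪v x, φ x⟫ ≤ s) :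
    (∫ x, ⟪curl v x, fderiv ℝ v x (curl v x)⟫) * (∫ x, (⟪curl φ x, fderiv ℝ v x (curl v x)⟫ + ⟪curl v x, fderiv ℝ φ x (curl v x)⟫ + ⟪curl v x, fderiv ℝ v x (curl φ x)⟫)) ≤
      (sInf {κ : ℝ | (∀ (v : EuclideanSpace ℝ (Fin 3) → EuclideanSpace ℝ (Fin 3)) (M B : ℝ), ContDiff ℝ (⊤ : ℕ∞) v → Literature.Analysis.FluidPDE.VectorCalculus.IsDivFree v → (∀ x, ‖v x‖ ≤ M) → (∀ x, ‖fderiv ℝ v x‖ ≤ B) → (∫⁻ x, ‖iteratedFDeriv ℝ 0 v x‖ₑ ^ 2 < ⊤) → (∫⁻ x, ‖iteratedFDeriv ℝ 1 v x‖ₑ ^ 2 < ⊤) → (∫⁻ x, ‖iteratedFDeriv ℝ 2 v x‖ₑ ^ 2 < ⊤) → |∫ x, ⟪Literature.Analysis.FluidPDE.curl v x, fderiv ℝ v x (Literature.Analysis.FluidPDE.curl v x)⟫_ℝ| ≤ κ * M * Real.sqrt (∫ x, ‖Literature.Analysis.FluidPDE.curl v x‖ ^ 2) * Real.sqrt (∫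 x, Literature.Analysis.FluidPDE.frobeniusNormSq (fderiv ℝ (Literature.Analysis.FluidPDE.curl v) x)))}) ^ 2 * M ^ 2 * (s / M ^ 2 * (∫ x, ‖curl v x‖ ^ 2) * (∫ x, frobeniusNormSq (fderiv ℝ (curl v) x)) + (∫ x, frobeniusNormSq (fderiv ℝ (curl v) x)) * (∫ x, ⟪curl v x, curl φ x⟫) + (∫ x, ‖curl v x‖ ^ 2) * (∫ x, ∑ i, ⟪fderiv ℝ (curl v) x (EuclideanSpace.basisFun (Fin 3) ℝ i), fderiv ℝ (curl φ) x (EuclideanSpace.basisFun (Fin 3) ℝ i)⟫)) := by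
  set K : ℝ := (sInf {κ : ℝ | (∀ (v : EuclideanSpace ℝ (Fin 3) → EuclideanSpace ℝ (Fin 3)) (M B : ℝ), ContDiff ℝ (⊤ : ℕ∞) v → Literature.Analysis.FluidPDE.VectorCalculus.IsDivFree v → (∀ x, ‖v x‖ ≤ M) → (∀ x, ‖fderiv ℝ v x‖ ≤ B) → (∫⁻ x, ‖iteratedFDeriv ℝ 0 v x‖ₑ ^ 2 < ⊤) → (∫⁻ x, ‖iteratedFDeriv ℝ 1 v x‖ₑ ^ 2 < ⊤) → (∫⁻ x, ‖iteratedFDeriv ℝ 2 v x‖ₑ ^ 2 < ⊤) → |∫ x, ⟪Literature.Analysis.FluidPDE.curl v x, fderiv ℝ v x (Literature.Analysis.FluidPDE.curl v x)⟫_ℝ| ≤ κ * M * Real.sqrt (∫ x, ‖Literature.Analysis.FluidPDE.curl v x‖ ^ 2) * Real.sqrt (∫ x, Literature.Analysis.FluidPDE.frobeniusNormSq (fderiv ℝ (Literature.Analysis.FluidPDE.curl v) x)))}) with hK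
  have hZ0 : 0 ≤ ∫ x, ‖curl v x‖ ^ 2 := integral_nonneg fun x => sq_nonneg _
  have hW0 : 0 ≤ ∫ x, frobeniusNormSq (fderiv ℝ (curl v) x) := integral_nonneg fun x => frobeniusNormSq_nonneg _
  -- for every `η > 0` the one-sided bound holds with slope `(s + η)/M²`
  have key : ∀ η : ℝ, 0 < η →
      (∫ x, ⟪curl v x, fderiv ℝ v x (curl v x)⟫) * (∫ x, (⟪curl φ x, fderiv ℝ v x (curl v x)⟫ + ⟪curl v x, fderiv ℝ φ x (curl v x)⟫ + ⟪curl v x, fderiv ℝ v x (curl φ x)⟫)) ≤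
      K ^ 2 * M ^ 2 * ((s + η) / M ^ 2 * (∫ x, ‖curl v x‖ ^ 2) * (∫ x, frobeniusNormSq (fderiv ℝ (curl v) x)) + (∫ x, frobeniusNormSq (fderiv ℝ (curl v) x)) * (∫ x, ⟪curl v x, curl φ x⟫) + (∫ x, ‖curl v x‖ ^ 2) * (∫ x, ∑ i, ⟪fderiv ℝ (curl v) x (EuclideanSpace.basisFun (Fin 3) ℝ i), fderiv ℝ (curl φ) x (EuclideanSpace.basisFun (Fin 3) ℝ i)⟫)) := by
    intro η hη
    obtain ⟨m, hm⟩ : ∃ m : ℝ, m = (s + η) / M ^ 2 := ⟨_, rfl⟩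
    rw [← hm]
    have hε₀ : 0 < min (2 * η / (P ^ 2 + 1)) (1 / (|m| + 1)) := lt_min (by positivity) (by positivity)
    refine ext_firstVariation_le_of_oneSided_normBound_global hv hdiv hB h1 h2 hatt hφ hφdiv hC h1φ h2φ hε₀
      fun ε hε0 hε x => ?_
    have hε1 : ε < 2 * η / (P ^ 2 + 1) := lt_of_lt_of_le hε (min_le_left _ _)
    have hε2 : ε < 1 / (|m| + 1) := lt_of_lt_of_le hε (min_le_right _ _)
    refine norm_add_smul_le_of_inner_le (hM x) hMpos.le (hs x) (hP x) hε0 ?_ ?_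
    · have hms : m * M ^ 2 - s = η := by rw [hm]; field_simp; ring
      rw [hms]
      have hP2 : 0 < P ^ 2 + 1 := by positivity
      have h := (mul_le_mul_of_nonneg_right hε1.le (sq_nonneg P))
      refine h.trans ?_
      rw [div_mul_eq_mul_div, div_le_iff₀ hP2]
      nlinarith [sq_nonneg P]
    · have hmε : |m * ε| < 1 := by
        rw [abs_mul, abs_of_nonneg hε0]
        have h1' : |m| * ε ≤ |m| * (1 / (|m| + 1)) := mul_le_mul_of_nonneg_left hε2.le (abs_nonneg m)
        have h2' : |m| * (1 / (|m| + 1)) < 1 := by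
          rw [mul_one_div, div_lt_one (by positivity)]; linarith
        exact lt_of_le_of_lt h1' h2'
      have := neg_abs_le (m * ε)
      linarith
  -- let `η → 0`
  refine le_of_forall_pos_le_add fun ε hε => ?_
  have hKZW : 0 ≤ K ^ 2 * (∫ x, ‖curl v x‖ ^ 2) * (∫ x, frobeniusNormSq (fderiv ℝ (curl v) x)) := by positivity
  have h := key (ε / (K ^ 2 * (∫ x, ‖curl v x‖ ^ 2) * (∫ x, frobeniusNormSq (fderiv ℝ (curl v) x)) + 1)) (by positivity)
  have hsplit : K ^ 2 * M ^ 2 * ((s + ε / (K ^ 2 * (∫ x, ‖curl v x‖ ^ 2) * (∫ x, frobeniusNormSq (fderiv ℝ (curl v) x)) + 1)) / M ^ 2 * (∫ x, ‖curl v x‖ ^ 2) * (∫ x, frobeniusNormSq (fderiv ℝ (curl v) x)) + (∫ x, frobeniusNormSq (fderiv ℝ (curl v) x)) * (∫ x, ⟪curl v x, curl φ x⟫) + (∫ x, ‖curl v x‖ ^ 2) * (∫ x, ∑ i, ⟪fderiv ℝ (curl v) x (EuclideanSpace.basisFun (Fin 3) ℝ i), fderiv ℝ (curl φ) x (EuclideanSpace.basisFun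 (Fin 3) ℝ i)⟫)) =
      K ^ 2 * M ^ 2 * (s / M ^ 2 * (∫ x, ‖curl v x‖ ^ 2) * (∫ x, frobeniusNormSq (fderiv ℝ (curl v) x)) + (∫ x, frobeniusNormSq (fderiv ℝ (curl v) x)) * (∫ x, ⟪curl v x, curl φ x⟫) + (∫ x, ‖curl v x‖ ^ 2) * (∫ x, ∑ i, ⟪fderiv ℝ (curl v) x (EuclideanSpace.basisFun (Fin 3) ℝ i), fderiv ℝ (curl φ) x (EuclideanSpace.basisFun (Fin 3) ℝ i)⟫)) +
      K ^ 2 * (∫ x, ‖curl v x‖ ^ 2) * (∫ x, frobeniusNormSq (fderiv ℝ (curl v) x)) * (ε / (K ^ 2 * (∫ x, ‖curl v x‖ ^ 2) * (∫ x, frobeniusNormSq (fderiv ℝ (curl v) x)) + 1)) := by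
    field_simp
    ring
  rw [hsplit] at h
  have hlast : K ^ 2 * (∫ x, ‖curl v x‖ ^ 2) * (∫ x, frobeniusNormSq (fderiv ℝ (curl v) x)) *
      (ε / (K ^ 2 * (∫ x, ‖curl v x‖ ^ 2) * (∫ x, frobeniusNormSq (fderiv ℝ (curl v) x)) + 1)) ≤ ε := by
    rw [mul_div_assoc', div_le_iff₀ (by positivity)]
    nlinarith
  linarith

/-! ## The translation inequality -/

/-- For a constant-speed field, the chord direction `ψ = v(·+h) − v` points inward: `⟪v x, ψ x⟫ = −‖ψ x‖²/2`. [folklore] -/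
theorem inner_translate_sub_eq {M : ℝ} (hM : ∀ x, ‖v x‖ = M) (h x : EuclideanSpace ℝ (Fin 3)) :
    ⟪v x, v (x + h) - v x⟫ = -(‖v (x + h) - v x‖ ^ 2 / 2) := by
  have h1 : ‖v (x + h) - v x‖ ^ 2 = ‖v (x + h)‖ ^ 2 - 2 * ⟪v (x + h), v x⟫ + ‖v x‖ ^ 2 := norm_sub_sq_real _ _
  rw [hM x, hM (x + h), real_inner_comm (v x) (v (x + h))] at h1
  rw [inner_sub_right, real_inner_self_eq_norm_sq, hM x]
  linarith

/-- **THE TRANSLATION INEQUALITY.**  For a constant-speed extended extremiser `v` (`‖v‖ ≡ M > 0`, bounded gradient,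
`D¹v, D²v ∈ L²`, `|S| = κ⋆M√Z√W`) and every `h ∈ ℝ³`, the global direction `ψ = v(·+h) − v` satisfies `⟪v, ψ⟫ ≤ 0`, hence
**`S·J₁(ψ) ≤ κ⋆²M²(W a₁(ψ) + Z c₁(ψ))`**, i.e. `ℓ(v(·+h)) ≤ ℓ(v) = S²` — the residue object maximises `h ↦ ℓ(v(·+h))` at `h = 0`
(a two-point autocorrelation inequality; at second order in `h`: `κ⋆²M²(W‖∂_hω‖² + Z‖∂_h∇ω‖²) ≤ −S·J₁(∂_h²v)`, not derived here). [folklore] -/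
theorem firstVariation_translate_sub_le
    (hv : ContDiff ℝ ∞ v) (hdiv : VectorCalculus.IsDivFree v) {M B : ℝ} (hMpos : 0 < M)
    (hM : ∀ x, ‖v x‖ = M) (hB : ∀ x, ‖fderiv ℝ v x‖ ≤ B)
    (h1 : ∫⁻ x, ‖iteratedFDeriv ℝ 1 v x‖ₑ ^ 2 < ⊤) (h2 : ∫⁻ x, ‖iteratedFDeriv ℝ 2 v x‖ₑ ^ 2 < ⊤)
    (hatt : |∫ x, ⟪curl v x, fderiv ℝ v x (curl v x)⟫| = (sInf {κ : ℝ | (∀ (v : EuclideanSpace ℝ (Fin 3) → EuclideanSpace ℝ (Fin 3)) (M B : ℝ), ContDiff ℝ (⊤ : ℕ∞) v → Literature.Analysis.FluidPDE.VectorCalculus.IsDivFree v → (∀ x, ‖v x‖ ≤ M) → (∀ x, ‖fderiv ℝ v x‖ ≤ B) → (∫⁻ x, ‖iteratedFDeriv ℝ 0 v x‖ₑ ^ 2 < ⊤) → (∫⁻ x, ‖iteratedFDeriv ℝ 1 v x‖ₑ ^ 2 < ⊤) → (∫⁻ x, ‖iteratedFDeriv ℝ 2 v x‖ₑ ^ 2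 < ⊤) → |∫ x, ⟪Literature.Analysis.FluidPDE.curl v x, fderiv ℝ v x (Literature.Analysis.FluidPDE.curl v x)⟫_ℝ| ≤ κ * M * Real.sqrt (∫ x, ‖Literature.Analysis.FluidPDE.curl v x‖ ^ 2) * Real.sqrt (∫ x, Literature.Analysis.FluidPDE.frobeniusNormSq (fderiv ℝ (Literature.Analysis.FluidPDE.curl v) x)))}) * M * Real.sqrt (∫ x, ‖curl v x‖ ^ 2) * Real.sqrt (∫ x, frobeniusNormSq (fderiv ℝ (curl v) x)))
    (h : EuclideanSpace ℝ (Fin 3)) :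
    let φ : EuclideanSpace ℝ (Fin 3) → EuclideanSpace ℝ (Fin 3) := fun x => v (x + h) - v x
    (∫ x, ⟪curl v x, fderiv ℝ v x (curl v x)⟫) * (∫ x, (⟪curl φ x, fderiv ℝ v x (curl v x)⟫ + ⟪curl v x, fderiv ℝ φ x (curl v x)⟫ + ⟪curl v x, fderiv ℝ v x (curl φ x)⟫)) ≤
      (sInf {κ : ℝ | (∀ (v : EuclideanSpace ℝ (Fin 3) → EuclideanSpace ℝ (Fin 3)) (M B : ℝ), ContDiff ℝ (⊤ : ℕ∞) v → Literature.Analysis.FluidPDE.VectorCalculus.IsDivFree v → (∀ x, ‖v x‖ ≤ M) → (∀ x, ‖fderiv ℝ v x‖ ≤ B) → (∫⁻ x, ‖iteratedFDeriv ℝ 0 v x‖ₑ ^ 2 < ⊤) → (∫⁻ x, ‖iteratedFDeriv ℝ 1 v x‖ₑ ^ 2 < ⊤) → (∫⁻ x, ‖iteratedFDeriv ℝ 2 v x‖ₑ ^ 2 < ⊤) → |∫ x, ⟪Literature.Analysis.FluidPDE.curl v x, fderiv ℝ v x (Literature.Analysis.FluidPDE.curl v x)⟫_ℝ| ≤ κ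 * M * Real.sqrt (∫ x, ‖Literature.Analysis.FluidPDE.curl v x‖ ^ 2) * Real.sqrt (∫ x, Literature.Analysis.FluidPDE.frobeniusNormSq (fderiv ℝ (Literature.Analysis.FluidPDE.curl v) x)))}) ^ 2 * M ^ 2 * (0 / M ^ 2 * (∫ x, ‖curl v x‖ ^ 2) * (∫ x, frobeniusNormSq (fderiv ℝ (curl v) x)) + (∫ x, frobeniusNormSq (fderiv ℝ (curl v) x)) * (∫ x, ⟪curl v x, curl φ x⟫) + (∫ x, ‖curl v x‖ ^ 2) * (∫ x, ∑ i, ⟪fderiv ℝ (curl v) x (EuclideanSpace.basisFun (Fin 3) ℝ i), fderiv ℝ (curl φ) x (EuclideanSpace.basisFun (Fin 3) ℝ i)⟫)) := by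
  intro φ
  set vh : EuclideanSpace ℝ (Fin 3) → EuclideanSpace ℝ (Fin 3) := fun x => v (x + h) with hvh
  have hvh_cd : ContDiff ℝ ∞ vh := hv.comp (contDiff_id.add contDiff_const)
  have hvd : Differentiable ℝ v := hv.differentiable (by simp)
  have hDvh : ∀ x, fderiv ℝ vh x = fderiv ℝ v (x + h) := fun x => by
    simp only [hvh]
    rw [fderiv_comp_add_right]
  have hφdef : φ = fun x => vh x - v x := rfl
  have hφ : ContDiff ℝ ∞ φ := by rw [hφdef]; exact hvh_cd.sub hv
  have hvh_div : VectorCalculus.IsDivFree vh := fun x => by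
    have := hdiv (x + h)
    simp only [VectorCalculus.divergence] at this ⊢
    rw [hDvh]; exact this
  have hφdiv : VectorCalculus.IsDivFree φ := fun x => by
    have e : φ = fun y => vh y + (-1 : ℝ) • v y := by funext y; simp [hφdef, sub_eq_add_neg]
    rw [e, divergence_add_smul (hvh_cd.differentiable (by simp)) hvd, hvh_div x, hdiv x, mul_zero, add_zero]
  have hP : ∀ x, ‖φ x‖ ≤ 2 * M := fun x =>
    (norm_sub_le (v (x + h)) (v x)).trans (by rw [hM, hM]; linarith)
  have hC : ∀ x, ‖fderiv ℝ φ x‖ ≤ B + B := fun x => by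
    have e : fderiv ℝ φ x = fderiv ℝ vh x - fderiv ℝ v x := by
      rw [hφdef]; exact fderiv_sub ((hvh_cd.differentiable (by simp)) x) (hvd x)
    rw [e, hDvh]
    exact (norm_sub_le _ _).trans (add_le_add (hB _) (hB _))
  have hk : ∀ k : ℕ, (∫⁻ x, ‖iteratedFDeriv ℝ k v x‖ₑ ^ 2 < ⊤) → ∫⁻ x, ‖iteratedFDeriv ℝ k φ x‖ₑ ^ 2 < ⊤ := by
    intro k hkv
    have htr : ∀ x, iteratedFDeriv ℝ k vh x = iteratedFDeriv ℝ k v (x + h) := fun x => by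
      simp only [hvh]; rw [iteratedFDeriv_comp_add_right]
    have hkvh : ∫⁻ x, ‖iteratedFDeriv ℝ k vh x‖ₑ ^ 2 < ⊤ := by
      have e : (fun x => ‖iteratedFDeriv ℝ k vh x‖ₑ ^ 2) = fun x => (fun y => ‖iteratedFDeriv ℝ k v y‖ₑ ^ 2) (x + h) := by funext x; simp only [htr]
      rw [e, lintegral_add_right_eq_self (fun y => ‖iteratedFDeriv ℝ k v y‖ₑ ^ 2) h]
      exact hkv
    have e : φ = fun y => vh y + (-1 : ℝ) • v y := by funext y; simp [hφdef, sub_eq_add_neg]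
    rw [e]
    exact lintegral_iteratedFDeriv_add_smul_lt_top_global hvh_cd hv (-1) hkvh hkv
  have hs : ∀ x, ⟪v x, φ x⟫ ≤ 0 := fun x => by
    show ⟪v x, v (x + h) - v x⟫ ≤ 0
    rw [inner_translate_sub_eq hM]
    linarith [sq_nonneg ‖v (x + h) - v x‖]
  exact ext_firstVariation_le_of_inner_le_global hv hdiv hMpos hM hB h1 h2 hatt hφ hφdiv hP hC (hk 1 h1) (hk 2 h2) hs

end ExtremiserLiouville

end Summit.NavierStokesRegularity.NavierStokesRegularity.Theorems

end
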